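import Mathlib
import HarnessLib
import Summits.NavierStokesRegularity.NavierStokesRegularity.Theorems.HalfSpaceWindowDoorCirculationCarryingRigidityConeFluxSubsolution
import Summits.NavierStokesRegularity.NavierStokesRegularity.Theorems.HalfSpaceWindowDoorCirculationCarryingRigidityAngularMeanDrift
import Literature.Analysis.FluidPDE.MeridianReduction

/-!
# Route `HalfSpaceWindowDoor`, crux `CirculationCarryingRigidity` (stmt-NavierStokesRegularity-25311) — line `eddy_covariance`:
# calculus of the LINEAR barrier `L(t)|x_h|`, `L(t) = 2πC ((−t)(−s₀))^{−1/4}`, for the scale-invariant («quiet circles») form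

LEAD ns-hsw-p1 g10, `--supports 25311 --as helper`; card `Cruxes/…/Lines/eddy_covariance.md`.  The quadratic barrier `μ + A|x_h|²/√(s s₀)` of
the sweeping lemma forces, at a touching point, `∮ω₃ dl ≈ 2A|x_h|/√(t s₀)` — small only relative to the dimensionful `1/√(−s₀)`.  Replacing
the bulk of the barrier by the LINEAR profile `L(t)|x_h|`, `L(t) = 2πC((−t)(−s₀))^{−1/4}` (which dominates the Stokes bound `2πC|x_h|/√(−s₀)`
at `t = s₀`, grows like `(s₀/t)^{1/4}`, i.e. `L' = L/(4(−t))`, and is a supersolution of the swept operator outside the tube `|x_h| ≥ 4B'√(−t)`: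
`L'r + (2/r − B'/√(−t))L − L/r ≥ L(r/(4(−t)) − B'/√(−t)) ≥ 0`), plus an arbitrarily SMALL quadratic term, makes the touching circles flat
in the SCALE-INVARIANT sense `(−t)∮ω₃ dl ≤ η₀|x_h|` (`L(t)(−t)/|x_h| ≤ 2πC(t/s₀)^{1/4}/R₁ ≤ 2πC/R₁`).  This file: the derivative of
`t ↦ ((−t)(−s₀))^{−1/4}` (`hasDerivAt_quarter`), its size (`quarter_mul_sqrt_le_one`), the slice calculus of `y ↦ c|y_h|` off the axis
(`fderiv_const_mul_cylRadius`, `laplacian_const_mul_cylRadius`, `contDiffAt_const_mul_cylRadius`), the slack of the linear barrier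
(`linear_barrier_slack_nonneg`), and joint continuity (`continuousOn_quarter_mul_cylRadius`).
WHAT THIS IS NOT: not about NS regularity; barrier calculus for HYPOTHETICAL blow-up profiles.  No item is closed by this file.
-/

noncomputable section

-- the summit and its single sub-problem share the name (CONVENTIONS §1), as in every Theorems file
set_option linter.dupNamespace false

namespace Summit.NavierStokesRegularity.NavierStokesRegularity.Theorems.HalfSpaceWindowDoorCirculationCarryingRigidityQuietTools

open MeasureTheory Set Function Filter Topology InnerProductSpace
open scoped RealInnerProductSpace InnerProductSpace Laplacian
open Literature.Analysis Literature.Analysis.UnboundedOperators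
open Literature.Analysis.FluidPDE hiding eR
open Summit.NavierStokesRegularity.NavierStokesRegularity.Theorems.HalfSpaceWindowDoorCirculationCarryingRigidityDefs
  (InDoorClass SignE3 e3)
open Summit.NavierStokesRegularity.NavierStokesRegularity.Theorems.AxisTwistDoorAveragedConeLiouvilleDefs
  (cylPt eT eR circ vortCirc radVortCirc tiltCirc circleTerm meanR meanZ remainder)
open Summit.NavierStokesRegularity.NavierStokesRegularity.Theorems.AveragedConeLiouville.CircleStokes (continuous_eR)
open Summit.NavierStokesRegularity.NavierStokesRegularity.Theorems.AxisTwistDoorAveragedConeLiouvilleCylFrame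
  (continuous_cylPt_θ abs_inner_eR_le abs_inner_e3_le abs_integral_le_const_mul_add norm_eR)
open Summit.NavierStokesRegularity.NavierStokesRegularity.Theorems.AveragedConeLiouville.CircleStokes
  (deriv_circ_eq_vortCirc)
open Summit.NavierStokesRegularity.NavierStokesRegularity.Theorems.AveragedConeLiouville.CircleCalculus (deriv_circ_z)
open Summit.NavierStokesRegularity.NavierStokesRegularity.Theorems.AveragedConeLiouville.CircMonotone
  (circ_zero circ_mono circ_nonneg vortCirc_nonneg)
open Summit.NavierStokesRegularity.NavierStokesRegularity.Theorems.HalfSpaceWindowDoorCirculationCarryingRigidityAxisCirculation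
  (contDiff_circF isSmoothSpaceTimeOn_circF isSmoothSpaceTimeOn_of_class fderiv_circF_eR laplacian_circF hasDerivAt_circF_time
    contDiffOn_circ)
open Summit.NavierStokesRegularity.NavierStokesRegularity.Theorems.AxisTwistDoorAveragedConeLiouvilleAxisLift
  (lift gradient_lift contDiffAt_lift)

open Summit.NavierStokesRegularity.NavierStokesRegularity.Theorems.HalfSpaceWindowDoorCirculationCarryingRigidityConeFluxSubsolution


open Summit.NavierStokesRegularity.NavierStokesRegularity.Theorems.AxisTwistDoorAveragedConeLiouvilleAxisLift
  (lift laplacian_lift contDiffAt_lift)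

variable {C : ℝ} {v : ℝ → EuclideanSpace ℝ (Fin 3) → EuclideanSpace ℝ (Fin 3)}

/-! ### The quarter-root factor `Q(t) = (√(−t)·√(−s₀))^{−1/2} = ((−t)(−s₀))^{−1/4}` -/

/-- `Q(s₀) = 1/√(−s₀)`. -/
theorem quarter_at_self (s₀ : ℝ) :
    (Real.sqrt (Real.sqrt (-s₀) * Real.sqrt (-s₀)))⁻¹ = (Real.sqrt (-s₀))⁻¹ := by
  rw [Real.sqrt_mul_self (Real.sqrt_nonneg _)]

/-- `Q(t)·√(−t) ≤ 1` for `s₀ ≤ t < 0` (i.e. `((−t)/(−s₀))^{1/4} ≤ 1`). -/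
theorem quarter_mul_sqrt_le_one {s₀ t : ℝ} (ht : t < 0) (hts₀ : s₀ ≤ t) :
    (Real.sqrt (Real.sqrt (-t) * Real.sqrt (-s₀)))⁻¹ * Real.sqrt (-t) ≤ 1 := by
  have hsqt : 0 < Real.sqrt (-t) := Real.sqrt_pos.2 (neg_pos.2 ht)
  have hsq₀ : 0 < Real.sqrt (-s₀) := Real.sqrt_pos.2 (by linarith)
  have hg : 0 < Real.sqrt (Real.sqrt (-t) * Real.sqrt (-s₀)) := Real.sqrt_pos.2 (mul_pos hsqt hsq₀)
  rw [inv_mul_le_iff₀ hg, mul_one]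
  have hst : Real.sqrt (-t) ≤ Real.sqrt (-s₀) := Real.sqrt_le_sqrt (by linarith)
  have h1 : Real.sqrt (-t) * Real.sqrt (-t) ≤ Real.sqrt (-t) * Real.sqrt (-s₀) := mul_le_mul_of_nonneg_left hst hsqt.le
  calc Real.sqrt (-t) = Real.sqrt (Real.sqrt (-t) * Real.sqrt (-t)) := (Real.sqrt_mul_self hsqt.le).symm
    _ ≤ Real.sqrt (Real.sqrt (-t) * Real.sqrt (-s₀)) := Real.sqrt_le_sqrt h1

/-- `Q(t)·(−t) ≤ √(−s₀)` for `s₀ ≤ t < 0`. -/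
theorem quarter_mul_neg_le {s₀ t : ℝ} (ht : t < 0) (hts₀ : s₀ ≤ t) :
    (Real.sqrt (Real.sqrt (-t) * Real.sqrt (-s₀)))⁻¹ * (-t) ≤ Real.sqrt (-s₀) := by
  have hsqt : 0 < Real.sqrt (-t) := Real.sqrt_pos.2 (neg_pos.2 ht)
  have h := quarter_mul_sqrt_le_one ht hts₀
  have hst : Real.sqrt (-t) ≤ Real.sqrt (-s₀) := Real.sqrt_le_sqrt (by linarith)
  have e : (Real.sqrt (Real.sqrt (-t) * Real.sqrt (-s₀)))⁻¹ * (-t) =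
      ((Real.sqrt (Real.sqrt (-t) * Real.sqrt (-s₀)))⁻¹ * Real.sqrt (-t)) * Real.sqrt (-t) := by
    rw [mul_assoc, Real.mul_self_sqrt (neg_pos.2 ht).le]
  rw [e]
  calc (Real.sqrt (Real.sqrt (-t) * Real.sqrt (-s₀)))⁻¹ * Real.sqrt (-t) * Real.sqrt (-t) ≤ 1 * Real.sqrt (-t) :=
        mul_le_mul_of_nonneg_right h hsqt.le
    _ ≤ Real.sqrt (-s₀) := by rw [one_mul]; exact hst

/-- **`Q' = Q/(4(−t))`**: the derivative of `t ↦ (√(−t)√(−s₀))^{−1/2}` on `t < 0`. -/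
theorem hasDerivAt_quarter {t s₀ : ℝ} (ht : t < 0) (hs₀ : s₀ < 0) :
    HasDerivAt (fun τ : ℝ => (Real.sqrt (Real.sqrt (-τ) * Real.sqrt (-s₀)))⁻¹)
      ((Real.sqrt (Real.sqrt (-t) * Real.sqrt (-s₀)))⁻¹ / (4 * (-t))) t := by
  have hsqt : 0 < Real.sqrt (-t) := Real.sqrt_pos.2 (neg_pos.2 ht)
  have hsq₀ : 0 < Real.sqrt (-s₀) := Real.sqrt_pos.2 (neg_pos.2 hs₀)
  have hgpos : 0 < Real.sqrt (-t) * Real.sqrt (-s₀) := mul_pos hsqt hsq₀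
  have hh : 0 < Real.sqrt (Real.sqrt (-t) * Real.sqrt (-s₀)) := Real.sqrt_pos.2 hgpos
  -- `g(τ) = √(−τ)√(−s₀)`, `g' = −√(−s₀)/(2√(−t))`
  have h1 : HasDerivAt (fun τ : ℝ => Real.sqrt (-τ)) (-(1 / (2 * Real.sqrt (-t)))) t := by
    have := ((hasDerivAt_neg t).sqrt (by linarith))
    convert this using 1; ring
  have hg : HasDerivAt (fun τ : ℝ => Real.sqrt (-τ) * Real.sqrt (-s₀)) (-(1 / (2 * Real.sqrt (-t))) * Real.sqrt (-s₀)) t :=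
    h1.mul_const _
  -- `h = √g`, `h' = g'/(2√g)`; then `(h⁻¹)' = −h'/h²`
  have hsq := hg.sqrt hgpos.ne'
  have hinv := hsq.inv hh.ne'
  refine hinv.congr_deriv ?_
  have htt : Real.sqrt (-t) * Real.sqrt (-t) = -t := Real.mul_self_sqrt (neg_pos.2 ht).le
  have hhh : Real.sqrt (Real.sqrt (-t) * Real.sqrt (-s₀)) ^ 2 = Real.sqrt (-t) * Real.sqrt (-s₀) := Real.sq_sqrt hgpos.le
  set H : ℝ := Real.sqrt (Real.sqrt (-t) * Real.sqrt (-s₀)) with hH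
  rw [hhh, div_eq_div_iff (mul_ne_zero hsqt.ne' hsq₀.ne') (by nlinarith : (4 : ℝ) * (-t) ≠ 0)]
  have htt2 : Real.sqrt (-t) ^ 2 = -t := Real.sq_sqrt (neg_pos.2 ht).le
  field_simp
  rw [htt2]
  ring

/-! ### The slice `y ↦ c·|y_h|` off the axis -/

/-- `D[c|·_h|](x) w = c⟪e_r(x), w⟫` off the axis. -/
theorem fderiv_const_mul_cylRadius {x : EuclideanSpace ℝ (Fin 3)} (hx : cylRadius x ≠ 0) (c : ℝ) (w : EuclideanSpace ℝ (Fin 3)) :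
    fderiv ℝ (fun y => c * cylRadius y) x w = c * ⟪Literature.Analysis.FluidPDE.eR x, w⟫_ℝ := by
  have h := (Literature.Analysis.FluidPDE.hasFDerivAt_cylRadius hx).const_mul c
  rw [h.fderiv]
  simp [smul_eq_mul]

/-- `y ↦ c|y_h|` is `C²` near every off-axis point. -/
theorem contDiffAt_const_mul_cylRadius {x : EuclideanSpace ℝ (Fin 3)} (hx : cylRadius x ≠ 0) (c : ℝ) :
    ContDiffAt ℝ 2 (fun y : EuclideanSpace ℝ (Fin 3) => c * cylRadius y) x := by
  have hΓ : ContDiffOn ℝ 2 (fun q : ℝ × ℝ × ℝ => (fun (r _ _ : ℝ) => c * r) q.1 q.2.1 q.2.2) {q | q.2.2 < 0} :=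
    (contDiff_const.mul contDiff_fst).contDiffOn
  exact contDiffAt_lift (Γ := fun (r _ _ : ℝ) => c * r) hΓ (show (-1 : ℝ) < 0 by norm_num) hx

/-- `Δ[c|·_h|](x) = c/|x_h|` off the axis (cylindrical Laplacian of `r ↦ cr`). -/
theorem laplacian_const_mul_cylRadius {x : EuclideanSpace ℝ (Fin 3)} (hx : cylRadius x ≠ 0) (c : ℝ) :
    (Δ (fun y : EuclideanSpace ℝ (Fin 3) => c * cylRadius y)) x = c * (cylRadius x)⁻¹ := by
  have hΓ : ContDiffOn ℝ 2 (fun q : ℝ × ℝ × ℝ => (fun (r _ _ : ℝ) => c * r) q.1 q.2.1 q.2.2) {q | q.2.2 < 0} :=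
    (contDiff_const.mul contDiff_fst).contDiffOn
  have h := laplacian_lift (Γ := fun (r _ _ : ℝ) => c * r) hΓ (show (-1 : ℝ) < 0 by norm_num) hx
  have e : lift (fun (r _ _ : ℝ) => c * r) (-1) = fun y : EuclideanSpace ℝ (Fin 3) => c * cylRadius y := rfl
  rw [e] at h
  rw [h]
  have h1 : deriv (fun r' : ℝ => c * r') = fun _ => c := by
    funext r'
    simp
  simp [h1, mul_comm]

/-! ### The slack of the linear barrier and joint continuity -/

/-- **Linear barrier slack**: `0 ≤ L'ρ + (2/ρ − B'/√(−t))L − L/ρ` for `L' = L/(4(−t))`, `L ≥ 0`, `ρ ≥ 4B'√(−t) > 0`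
(indeed `= L/ρ + L(ρ/(4(−t)) − B'/√(−t))`). -/
theorem linear_barrier_slack_nonneg {L ρ t B' : ℝ} (ht : t < 0) (hL : 0 ≤ L) (hρ : 0 < ρ) (hρ4 : 4 * B' * Real.sqrt (-t) ≤ ρ) :
    0 ≤ L / (4 * (-t)) * ρ + (2 / ρ - B' / Real.sqrt (-t)) * L - L * ρ⁻¹ := by
  have hsqt : 0 < Real.sqrt (-t) := Real.sqrt_pos.2 (neg_pos.2 ht)
  have htt : Real.sqrt (-t) * Real.sqrt (-t) = -t := Real.mul_self_sqrt (neg_pos.2 ht).le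
  have h1 : B' / Real.sqrt (-t) ≤ ρ / (4 * (-t)) := by
    rw [div_le_div_iff₀ hsqt (by linarith)]
    have := mul_le_mul_of_nonneg_right hρ4 hsqt.le
    nlinarith [this, htt]
  have h2 : 0 ≤ L / ρ := div_nonneg hL hρ.le
  have e : L / (4 * (-t)) * ρ + (2 / ρ - B' / Real.sqrt (-t)) * L - L * ρ⁻¹ =
      L * (ρ / (4 * (-t)) - B' / Real.sqrt (-t)) + L / ρ := by
    field_simp
    ring
  rw [e]
  exact add_nonneg (mul_nonneg hL (by linarith)) h2

/-- Joint continuity of `(t,x) ↦ Q(t)·|x_h|` on `[s₀,s₁] × ℝ³`, `s₁ < 0`. -/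
theorem continuousOn_quarter_mul_cylRadius {s₀ s₁ : ℝ} (hs₁ : s₁ < 0) (hs₀₁ : s₀ < s₁) :
    ContinuousOn (fun p : ℝ × EuclideanSpace ℝ (Fin 3) =>
      (Real.sqrt (Real.sqrt (-p.1) * Real.sqrt (-s₀)))⁻¹ * cylRadius p.2) (Icc s₀ s₁ ×ˢ univ) := by
  have hsq₀ : 0 < Real.sqrt (-s₀) := Real.sqrt_pos.2 (by linarith)
  refine ContinuousOn.mul ?_ (Literature.Analysis.FluidPDE.continuous_cylRadius.comp continuous_snd).continuousOn
  refine ContinuousOn.inv₀ ?_ fun p hp => ?_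
  · exact (Real.continuous_sqrt.comp ((Real.continuous_sqrt.comp (continuous_neg.comp continuous_fst)).mul
      continuous_const)).continuousOn
  · have ht : p.1 < 0 := lt_of_le_of_lt (mem_prod.1 hp).1.2 hs₁
    exact (Real.sqrt_pos.2 (mul_pos (Real.sqrt_pos.2 (neg_pos.2 ht)) hsq₀)).ne'

/-! ### Appendix (LEAD g10): the slice `y ↦ (2π)⁻¹(μ + κ|y_h|²) + L|y_h|` of the mixed barrier off the axis -/

/-- **Directional derivatives of the mixed barrier slice** off the axis:
`D[(2π)⁻¹(μ + κ(y₀²+y₁²)) + L|y_h|](x)(a e_r(x) + c e_z) = (2π)⁻¹κ·a·2|x_h| + L·a`, together with differentiability. -/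
theorem fderiv_mixed_barrier_dir {x : EuclideanSpace ℝ (Fin 3)} (hx : cylRadius x ≠ 0) (μ κ L a c : ℝ) :
    DifferentiableAt ℝ (fun y : EuclideanSpace ℝ (Fin 3) => (2 * Real.pi)⁻¹ * (μ + κ * (y 0 * y 0 + y 1 * y 1)) + L * cylRadius y) x ∧
    fderiv ℝ (fun y : EuclideanSpace ℝ (Fin 3) => (2 * Real.pi)⁻¹ * (μ + κ * (y 0 * y 0 + y 1 * y 1)) + L * cylRadius y) x
        (a • Literature.Analysis.FluidPDE.eR x + c • (eZ : EuclideanSpace ℝ (Fin 3))) =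
      (2 * Real.pi)⁻¹ * (κ * (a * (2 * cylRadius x))) + L * a := by
  set ρ := cylRadius x with hρ
  have hρ2 : ρ ^ 2 = x 0 * x 0 + x 1 * x 1 := by rw [cylRadius_sq x]; ring
  have hproj : ∀ (i : Fin 3) (w : EuclideanSpace ℝ (Fin 3)), EuclideanSpace.proj (𝕜 := ℝ) i w = w i := fun i w => rfl
  have hQ := HalfSpaceWindowDoorCirculationCarryingRigidityConeFluxSubsolution.hasFDerivAt_horizSq x
  have hhas : HasFDerivAt (fun y : EuclideanSpace ℝ (Fin 3) => (2 * Real.pi)⁻¹ * (μ + κ * (y 0 * y 0 + y 1 * y 1)) + L * cylRadius y)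
      ((2 * Real.pi)⁻¹ • (κ • ((x 0 • EuclideanSpace.proj (𝕜 := ℝ) (0 : Fin 3) + x 0 • EuclideanSpace.proj (𝕜 := ℝ) (0 : Fin 3)) +
        (x 1 • EuclideanSpace.proj (𝕜 := ℝ) (1 : Fin 3) + x 1 • EuclideanSpace.proj (𝕜 := ℝ) (1 : Fin 3)))) +
        L • innerSL ℝ (Literature.Analysis.FluidPDE.eR x)) x :=
    (((hQ.const_mul κ).const_add μ).const_mul ((2 * Real.pi)⁻¹)).add
      ((Literature.Analysis.FluidPDE.hasFDerivAt_cylRadius hx).const_mul L)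
  refine ⟨hhas.differentiableAt, ?_⟩
  have heR0 : (Literature.Analysis.FluidPDE.eR x) 0 = ρ⁻¹ * x 0 := by simp [Literature.Analysis.FluidPDE.eR, hρ]
  have heR1 : (Literature.Analysis.FluidPDE.eR x) 1 = ρ⁻¹ * x 1 := by simp [Literature.Analysis.FluidPDE.eR, hρ]
  have heZ0 : (eZ : EuclideanSpace ℝ (Fin 3)) 0 = 0 := by simp [eZ]
  have heZ1 : (eZ : EuclideanSpace ℝ (Fin 3)) 1 = 0 := by simp [eZ]
  have hinn : ⟪Literature.Analysis.FluidPDE.eR x, a • Literature.Analysis.FluidPDE.eR x + c • (eZ : EuclideanSpace ℝ (Fin 3))⟫_ℝ = a := by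
    rw [inner_add_right, real_inner_smul_right, real_inner_smul_right, Literature.Analysis.FluidPDE.inner_eR_self hx,
      Literature.Analysis.FluidPDE.inner_eR_eZ, mul_one, mul_zero, add_zero]
  have hw0 : (a • Literature.Analysis.FluidPDE.eR x + c • (eZ : EuclideanSpace ℝ (Fin 3))) 0 = a * (ρ⁻¹ * x 0) := by
    rw [PiLp.add_apply, PiLp.smul_apply, PiLp.smul_apply, smul_eq_mul, smul_eq_mul, heR0, heZ0, mul_zero, add_zero]
  have hw1 : (a • Literature.Analysis.FluidPDE.eR x + c • (eZ : EuclideanSpace ℝ (Fin 3))) 1 = a * (ρ⁻¹ * x 1) := by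
    rw [PiLp.add_apply, PiLp.smul_apply, PiLp.smul_apply, smul_eq_mul, smul_eq_mul, heR1, heZ1, mul_zero, add_zero]
  rw [hhas.fderiv]
  simp only [smul_apply, add_apply, hproj, smul_eq_mul, hw0, hw1, innerSL_apply_apply, hinn]
  have e : x 0 * (a * (ρ⁻¹ * x 0)) + x 0 * (a * (ρ⁻¹ * x 0)) +
      (x 1 * (a * (ρ⁻¹ * x 1)) + x 1 * (a * (ρ⁻¹ * x 1))) =
      a * (2 * (ρ⁻¹ * (x 0 * x 0 + x 1 * x 1))) := by ring
  rw [e, ← hρ2, pow_two, ← mul_assoc ρ⁻¹, inv_mul_cancel₀ hx, one_mul]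

/-- **The mixed barrier slice is `C²` near every off-axis point.** -/
theorem contDiffAt_mixed_barrier {x : EuclideanSpace ℝ (Fin 3)} (hx : cylRadius x ≠ 0) (μ κ L : ℝ) :
    ContDiffAt ℝ 2 (fun y : EuclideanSpace ℝ (Fin 3) => (2 * Real.pi)⁻¹ * (μ + κ * (y 0 * y 0 + y 1 * y 1)) + L * cylRadius y) x := by
  have hci : ∀ i : Fin 3, ContDiff ℝ 2 fun y : EuclideanSpace ℝ (Fin 3) => y i := fun i =>
    (EuclideanSpace.proj (𝕜 := ℝ) i : EuclideanSpace ℝ (Fin 3) →L[ℝ] ℝ).contDiff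
  have hQc : ContDiff ℝ 2 fun y : EuclideanSpace ℝ (Fin 3) => y 0 * y 0 + y 1 * y 1 :=
    ((hci 0).mul (hci 0)).add ((hci 1).mul (hci 1))
  exact (contDiff_const.mul (contDiff_const.add (contDiff_const.mul hQc))).contDiffAt.add (contDiffAt_const_mul_cylRadius hx L)

/-- **Laplacian of the mixed barrier slice** off the axis: `Δ[(2π)⁻¹(μ + κ|y_h|²) + L|y_h|](x) = (2π)⁻¹·4κ + L/|x_h|`. -/
theorem laplacian_mixed_barrier {x : EuclideanSpace ℝ (Fin 3)} (hx : cylRadius x ≠ 0) (μ κ L : ℝ) :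
    (Δ (fun y : EuclideanSpace ℝ (Fin 3) => (2 * Real.pi)⁻¹ * (μ + κ * (y 0 * y 0 + y 1 * y 1)) + L * cylRadius y)) x =
      (2 * Real.pi)⁻¹ * (κ * 4) + L * (cylRadius x)⁻¹ := by
  have hci : ∀ i : Fin 3, ContDiff ℝ 2 fun y : EuclideanSpace ℝ (Fin 3) => y i := fun i =>
    (EuclideanSpace.proj (𝕜 := ℝ) i : EuclideanSpace ℝ (Fin 3) →L[ℝ] ℝ).contDiff
  have hQc : ContDiff ℝ 2 fun y : EuclideanSpace ℝ (Fin 3) => y 0 * y 0 + y 1 * y 1 :=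
    ((hci 0).mul (hci 0)).add ((hci 1).mul (hci 1))
  have hQsq : (fun y : EuclideanSpace ℝ (Fin 3) => y 0 * y 0 + y 1 * y 1) = fun y => y 0 ^ 2 + y 1 ^ 2 := by funext y; ring
  have e : (fun y : EuclideanSpace ℝ (Fin 3) => (2 * Real.pi)⁻¹ * (μ + κ * (y 0 * y 0 + y 1 * y 1)) + L * cylRadius y) =
      ((fun _ : EuclideanSpace ℝ (Fin 3) => (2 * Real.pi)⁻¹ * μ) +
        ((2 * Real.pi)⁻¹ * κ) • (fun y : EuclideanSpace ℝ (Fin 3) => y 0 ^ 2 + y 1 ^ 2)) +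
        (fun y : EuclideanSpace ℝ (Fin 3) => L * cylRadius y) := by
    funext y
    simp only [Pi.add_apply, Pi.smul_apply, smul_eq_mul]
    ring
  rw [e]
  have hc1 : ContDiffAt ℝ 2 (fun _ : EuclideanSpace ℝ (Fin 3) => (2 * Real.pi)⁻¹ * μ) x := contDiffAt_const
  have hsq2 : ContDiffAt ℝ 2 (fun y : EuclideanSpace ℝ (Fin 3) => y 0 ^ 2 + y 1 ^ 2) x := by rw [← hQsq]; exact hQc.contDiffAt
  have hc2 : ContDiffAt ℝ 2 (((2 * Real.pi)⁻¹ * κ) • fun y : EuclideanSpace ℝ (Fin 3) => y 0 ^ 2 + y 1 ^ 2) x := by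
    rw [Pi.smul_def]; exact hsq2.const_smul ((2 * Real.pi)⁻¹ * κ)
  have hc12 : ContDiffAt ℝ 2 ((fun _ : EuclideanSpace ℝ (Fin 3) => (2 * Real.pi)⁻¹ * μ) +
      ((2 * Real.pi)⁻¹ * κ) • fun y : EuclideanSpace ℝ (Fin 3) => y 0 ^ 2 + y 1 ^ 2) x := hc1.add hc2
  have hlin2 : ContDiffAt ℝ 2 (fun y : EuclideanSpace ℝ (Fin 3) => L * cylRadius y) x := contDiffAt_const_mul_cylRadius hx L
  rw [ContDiffAt.laplacian_add hc12 hlin2, ContDiffAt.laplacian_add hc1 hc2, InnerProductSpace.laplacian_smul _ hsq2,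
    Literature.Analysis.FluidPDE.laplacian_rho x, laplacian_const_mul_cylRadius hx L]
  simp [smul_eq_mul]
  ring

end Summit.NavierStokesRegularity.NavierStokesRegularity.Theorems.HalfSpaceWindowDoorCirculationCarryingRigidityQuietTools

end
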